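import Summits.ResolutionOfSingularities.ResolutionOfSingularities.Theorems.FrobeniusLadderFInjectiveMacaulayficationStrictTransformChartN
import HarnessLib

/-!
# Strict-transform presentation of the point-blow-up charts of a COMPLETE INTERSECTION in `𝔸ⁿ` (any number of equations)

Support file for crux stmt-ResolutionOfSingularities-15315 (`FrobeniusLadder.FInjectiveMacaulayfication`), chain w45a, seat res-L1-w45a-stub-2 g13
(res-L1-w45a-plan-1 RULING R23.11 (2): «FLOOR columns = CI twins of `PointFloorLegalOfIsolated` / `PointFloorNotFullOfFedder` (chart ideal of `Bl_𝔪` of a CI =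
SATURATION `(θF₁, θF₂) : yᵢ^∞` …) — state the saturation lemma once, general `r` if it costs nothing»). [OURS · L1 W4.5a] — NOT a statement of the manuscript
[claim: Hironaka2017]; AI-written, weaker than expert review. Nothing of the crux is proved.

`…StrictTransformChartN.lean` presents the chart `D₊(x̄ᵢt)` of `Bl_𝔪 Spec (k[X]/(f))` as `k[X]/(g)` for a HYPERSURFACE (`θᵢ f = Xᵢ^μ g`, `(g)` prime, `Xᵢ ∉ (g)`).
Here the same for an ARBITRARY ideal `I ⊆ k[X₀, …, X_{n−1}]` (`R = k[X]/I`, `x j = X̄ⱼ`, `𝔪 = (x₀, …, x_{n−1})`), with the strict transform presented by ANY ideal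
`J` such that
  (a) `J` is prime and `Xᵢ ∉ J` (so `J` is saturated with respect to `Xᵢ` — this REPLACES the computation of the saturation `(θ(I)) : Xᵢ^∞`),
  (b) `θᵢ(I) ⊆ J` (the total transform lies in `J`), and
  (c) `J ⊆ (g₁, …, g_c)` for finitely many `g_l` with `θᵢ F_l = Xᵢ^{μ_l} g_l`, `F_l ∈ I` (every generator of `J` dies on the chart).
Then `k[X]/J ≅ (R[𝔪t])_{(x̄ᵢt)}`, the class of `Xᵢ` going to the exceptional equation `x̄ᵢ/1`. For a complete intersection `I = (F₁, …, F_c)` one takes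
`J = (g₁, …, g_c)` — or any other generating set of the same ideal — once `J` is known to be prime with `Xᵢ ∉ J`; (b) is then automatic (`strictTransformChartCI`).

* §1 `mem_of_map_eq_zero` — `ker ψ ⊆ J` for the chart substitution `ψ : Xᵢ ↦ x̄ᵢ, Xⱼ ↦ x̄ⱼ/x̄ᵢ` (clear denominators with ✓ `StrictTransformChartN.exists_pow_mul_eq`, pull back
  along `θ`, use (a), (b)).
* §2 `exists_ringEquiv_ci` — the abstract assembly (`π : k[X] ↠ R` with kernel `I`); ★ `strictTransformChartCI` — the form for `R = k[X]/(F₁, …, F_c)` with (b) discharged.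
[cite: StacksProject, Tag 0804 and Tag 052Q] [folklore: strict transform = saturation of the total transform]
-/

-- single-problem summit: the doubled namespace component is forced
set_option linter.dupNamespace false

noncomputable section

namespace Summit.ResolutionOfSingularities.ResolutionOfSingularities.Theorems.FInjectiveMacaulayfication.StrictTransformChartCI

open Literature.AlgebraicGeometry.Resolution MvPolynomial
open Summit.ResolutionOfSingularities.ResolutionOfSingularities.Theorems.FInjectiveMacaulayfication

/-! ## §1 The kernel of the chart substitution lies in `J` -/

section Chart

variable {k : Type*} [CommRing k] {R : Type*} [CommRing R] {n : ℕ}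
  (π : MvPolynomial (Fin n) k →+* R)
  (x : Fin n → R) {i : Fin n}
  (ψ : MvPolynomial (Fin n) k →+* Localization.Away (x i))

/-- **`ker ψ ⊆ J`** (CI form of ✓ `StrictTransformChartN.mem_span_of_map_eq_zero`): if `ψ h = 0`, clear denominators (`Xᵢ^N · h = θ H`), so `π H ↦ 0` in `R[1/x̄ᵢ]`,
hence `x̄ᵢ^m · π H = 0`, i.e. `Xᵢ^m · H ∈ ker π = I`; applying `θ` (which maps `I` into `J`) gives `Xᵢ^(m+N) · h ∈ J`, and `J` is prime with `Xᵢ ∉ J`. [folklore] -/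
theorem mem_of_map_eq_zero (hx : ∀ j, x j = π (X j))
    (θ : MvPolynomial (Fin n) k →+* MvPolynomial (Fin n) k) (hθC : ∀ c : k, θ (C c) = C c)
    (hθi : θ (X i) = X i) (hθj : ∀ j : Fin n, j ≠ i → θ (X j) = X j * X i)
    (hcomp : ψ.comp θ = (algebraMap R (Localization.Away (x i))).comp π)
    {I J : Ideal (MvPolynomial (Fin n) k)} (hπ : ∀ s, π s = 0 → s ∈ I) (hθI : ∀ s ∈ I, θ s ∈ J)
    (hJ : J.IsPrime) (hXi : X i ∉ J) {h : MvPolynomial (Fin n) k} (hh : ψ h = 0) : h ∈ J := by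
  obtain ⟨N, H, hH⟩ := StrictTransformChartN.exists_pow_mul_eq θ hθC hθi hθj h
  have h1 : algebraMap R (Localization.Away (x i)) (π H) = 0 := by
    have h1 := RingHom.congr_fun hcomp H
    rw [RingHom.comp_apply, RingHom.comp_apply, ← hH, map_mul, hh, mul_zero] at h1
    exact h1.symm
  obtain ⟨⟨_, m, rfl⟩, hm⟩ :=
    (IsLocalization.map_eq_zero_iff (Submonoid.powers (x i)) (Localization.Away (x i)) _).mp h1
  change x i ^ m * π H = 0 at hm
  have h2 : X i ^ m * H ∈ I := hπ _ (by rw [map_mul, map_pow, ← hx]; exact hm)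
  have h3 : θ (X i ^ m * H) = X i ^ (m + N) * h := by
    rw [map_mul, map_pow, hθi, ← hH, pow_add, mul_assoc]
  have h4 : X i ^ (m + N) * h ∈ J := h3 ▸ hθI _ h2
  rcases hJ.mem_or_mem h4 with h5 | h5
  · exact absurd (hJ.mem_of_pow_mem _ h5) hXi
  · exact h5

end Chart

/-! ## §2 The presentation -/

section Assembly

variable {k : Type*} [CommRing k] {R : Type*} [CommRing R] {n : ℕ}

/-- **Strict-transform presentation of a point-blow-up chart of `Spec (k[X]/I)`** (abstract form): `π : k[X₀, …, X_{n−1}] ↠ R` with kernel `I`, `x j = π (X j)`,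
`𝔪 = (x₀, …, x_{n−1})`; `θ` the chart substitution `Xᵢ ↦ Xᵢ`, `Xⱼ ↦ XⱼXᵢ`; `J` a PRIME ideal with `Xᵢ ∉ J`, `θ(I) ⊆ J`, and `J ⊆ (g₁, …, g_c)` where
`θ F_l = Xᵢ^{μ_l} g_l` for some `F_l ∈ I`. Then the chart ring `(R[𝔪t])_{(x̄ᵢt)}` of `Bl_𝔪 Spec R` is `k[X]/J`, the class of `Xᵢ` going to `x̄ᵢ/1`.
[cite: StacksProject, Tag 0804] -/
theorem exists_ringEquiv_ci (π : MvPolynomial (Fin n) k →+* R) (hπs : Function.Surjective π)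
    (x : Fin n → R) {i : Fin n} (hx : ∀ j, x j = π (X j)) {I J : Ideal (MvPolynomial (Fin n) k)}
    (hπ : ∀ s, π s = 0 ↔ s ∈ I) (hJ : J.IsPrime) (hXi : X i ∉ J)
    (θ : MvPolynomial (Fin n) k →+* MvPolynomial (Fin n) k)
    (hθC : ∀ c : k, θ (C c) = C c) (hθi : θ (X i) = X i)
    (hθj : ∀ j : Fin n, j ≠ i → θ (X j) = X j * X i) (hθI : ∀ s ∈ I, θ s ∈ J)
    {c : ℕ} (Fs gs : Fin c → MvPolynomial (Fin n) k) (μ : Fin c → ℕ) (hFs : ∀ l, Fs l ∈ I)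
    (hθF : ∀ l, θ (Fs l) = X i ^ μ l * gs l) (hJle : J ≤ Ideal.span (Set.range gs)) :
    ∃ e : (MvPolynomial (Fin n) k ⧸ J) ≃+*
        HomogeneousLocalization.Away (reesGrading (Ideal.span (Set.range x)))
          (reesT (x i) (Ideal.subset_span (Set.mem_range_self i))),
      e (Ideal.Quotient.mk J (X i)) =
        reesChartBase (x i) (Ideal.subset_span (Set.mem_range_self i)) (x i) := by
  have ha : x i ∈ Ideal.span (Set.range x) := Ideal.subset_span (Set.mem_range_self i)
  -- the substitution `ψ : X i ↦ a, X j ↦ x j / a, c ↦ π c`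
  let ψ : MvPolynomial (Fin n) k →+* Localization.Away (x i) :=
    MvPolynomial.eval₂Hom ((algebraMap R (Localization.Away (x i))).comp (π.comp MvPolynomial.C))
      fun j => if j = i then algebraMap R (Localization.Away (x i)) (x i)
        else algebraMap R (Localization.Away (x i)) (x j) * IsLocalization.Away.invSelf (x i)
  have hψC : ∀ c, ψ (C c) = algebraMap R (Localization.Away (x i)) (π (C c)) := fun c =>
    MvPolynomial.eval₂Hom_C _ _ c
  have hψi : ψ (X i) = algebraMap R (Localization.Away (x i)) (x i) := by
    simp [ψ]
  have hψj : ∀ j, j ≠ i → ψ (X j) =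
      algebraMap R (Localization.Away (x i)) (x j) * IsLocalization.Away.invSelf (x i) := by
    intro j hj
    simp [ψ, hj]
  have hcomp := StrictTransformChartN.comp_eq π x ψ hx hψC hψi hψj θ hθC hθi hθj
  have hι : ∀ r : R, ∃ s, ψ s = algebraMap R (Localization.Away (x i)) r := by
    intro r
    obtain ⟨s, rfl⟩ := hπs r
    exact ⟨θ s, RingHom.congr_fun hcomp s⟩
  have hmem := StrictTransformChartN.map_mem_blowupAlgebra π x ψ hψC hψi hψj
  -- `ψ` with codomain restricted to `R[𝔪/a]`: surjective with kernel `J`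
  let ψ' : MvPolynomial (Fin n) k →+* blowupAlgebra (Ideal.span (Set.range x)) (x i) :=
    ψ.codRestrict (blowupAlgebra (Ideal.span (Set.range x)) (x i)).toSubring hmem
  have hsurj : Function.Surjective ψ' := fun z => by
    obtain ⟨s, hs⟩ := StrictTransformChartN.exists_map_eq_of_mem_blowupAlgebra x ψ hψj hι z.2
    exact ⟨s, Subtype.ext hs⟩
  have hgs0 : ∀ l, ψ (gs l) = 0 := fun l =>
    StrictTransformChartN.map_eq_zero_of_transform π x ψ hψi θ hcomp (hθF l) ((hπ (Fs l)).mpr (hFs l))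
  have hker : RingHom.ker ψ' = J := by
    apply le_antisymm
    · intro h hh
      exact mem_of_map_eq_zero π x ψ hx θ hθC hθi hθj hcomp (fun s => (hπ s).mp) hθI hJ hXi
        (congrArg Subtype.val (RingHom.mem_ker.mp hh))
    · intro h hh
      have hspan : Ideal.span (Set.range gs) ≤ RingHom.ker ψ' := by
        rw [Ideal.span_le]
        rintro _ ⟨l, rfl⟩
        rw [SetLike.mem_coe, RingHom.mem_ker]
        exact Subtype.ext (hgs0 l)
      exact hspan (hJle hh)
  refine ⟨(Ideal.quotEquivOfEq hker.symm).trans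
    ((RingHom.quotientKerEquivOfSurjective hsurj).trans (reesChartEquiv (x i) ha).symm), ?_⟩
  rw [RingEquiv.trans_apply, RingEquiv.trans_apply, Ideal.quotEquivOfEq_mk,
    RingHom.quotientKerEquivOfSurjective_apply_mk, RingEquiv.symm_apply_eq,
    reesChartEquiv_reesChartBase]
  exact Subtype.ext hψi

end Assembly

/-- ★ **STRICT TRANSFORM CHART OF A COMPLETE INTERSECTION in `𝔸ⁿ`**: `R = k[X₀, …, X_{n−1}]/(F₁, …, F_c)`, `x j` the classes of the variables, `𝔪 = (x₀, …, x_{n−1})`;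
if the chart substitution `θᵢ : Xᵢ ↦ Xᵢ, Xⱼ ↦ XⱼXᵢ` gives `θᵢ F_l = Xᵢ^{μ_l} · g_l` for every `l`, and `J` is a PRIME ideal with `Xᵢ ∉ J`, `g_l ∈ J` for all `l` and
`J ⊆ (g₁, …, g_c)` (i.e. `J` is the ideal of the strict transforms, in any presentation), then the chart ring `(R[𝔪t])_{(x̄ᵢt)}` of the point blow-up `Bl_𝔪 Spec R` is
`k[X₀, …, X_{n−1}]/J`, the class of `Xᵢ` being the exceptional equation `x̄ᵢ/1`. (The primality of `J` with `Xᵢ ∉ J` is exactly the statement that `(g₁, …, g_c)` is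
already saturated with respect to `Xᵢ`; for `c = 1` this is ✓ `StrictTransformChartN.stub_strictTransformChartN`.) [cite: StacksProject, Tag 0804] -/
theorem strictTransformChartCI (k : Type) [Field k] (n c : ℕ) (Fs gs : Fin c → MvPolynomial (Fin n) k) (i : Fin n) (μ : Fin c → ℕ)
    (J : Ideal (MvPolynomial (Fin n) k)) (hJ : J.IsPrime) (hXi : X i ∉ J) (hgsJ : ∀ l, gs l ∈ J)
    (hJle : J ≤ Ideal.span (Set.range gs))
    (hθF : ∀ l, aeval (fun j : Fin n => if j = i then (X i : MvPolynomial (Fin n) k) else X j * X i) (Fs l) = X i ^ μ l * gs l)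
    (x : Fin n → MvPolynomial (Fin n) k ⧸ Ideal.span (Set.range Fs))
    (hx : x = fun j : Fin n => Ideal.Quotient.mk (Ideal.span (Set.range Fs)) (X j)) :
    ∃ e : (MvPolynomial (Fin n) k ⧸ J) ≃+*
        HomogeneousLocalization.Away (reesGrading (Ideal.span (Set.range x)))
          (reesT (x i) (Ideal.subset_span (Set.mem_range_self i))),
      e (Ideal.Quotient.mk J (X i)) = reesChartBase (x i) (Ideal.subset_span (Set.mem_range_self i)) (x i) := by
  set θ : MvPolynomial (Fin n) k →+* MvPolynomial (Fin n) k :=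
    (aeval fun j : Fin n => if j = i then (X i : MvPolynomial (Fin n) k) else X j * X i).toRingHom with hθ
  have hθF' : ∀ l, θ (Fs l) = X i ^ μ l * gs l := fun l => hθF l
  -- the total transform lies in `J`
  have hθI : ∀ s ∈ Ideal.span (Set.range Fs), θ s ∈ J := by
    intro s hs
    have h1 : θ s ∈ (Ideal.span (Set.range Fs)).map θ := Ideal.mem_map_of_mem θ hs
    rw [Ideal.map_span] at h1
    refine (Ideal.span_le.mpr ?_) h1
    rintro _ ⟨_, ⟨l, rfl⟩, rfl⟩
    rw [SetLike.mem_coe, hθF' l]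
    exact J.mul_mem_left _ (hgsJ l)
  exact exists_ringEquiv_ci (Ideal.Quotient.mk (Ideal.span (Set.range Fs))) Ideal.Quotient.mk_surjective x
    (fun j => congrFun hx j) (fun s => Ideal.Quotient.eq_zero_iff_mem) hJ hXi θ
    (fun c => MvPolynomial.algHom_C _ c) ((MvPolynomial.aeval_X _ i).trans (if_pos rfl))
    (fun j hj => (MvPolynomial.aeval_X _ j).trans (if_neg hj)) hθI Fs gs μ (fun l => Ideal.subset_span ⟨l, rfl⟩) hθF' hJle

end Summit.ResolutionOfSingularities.ResolutionOfSingularities.Theorems.FInjectiveMacaulayfication.StrictTransformChartCI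

end
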